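/-
# STUB_IDEAS_stub_heegnerIndexLowerAtTwo_1_g42.lean — stub-ideation k1 g42 (TECHNIQUE «weaken / strengthen»)
crux item stmt-BirchSwinnertonDyer-27851 = `PrintCf2.SplitBadTwoLowerHalfOfFacts`, STUB `stub_heegnerIndexLowerAtTwo`
(registered skeleton of record, sha16 `f2bd84c029a8a938`), written against STUB-PLAN v7.8 (g44 rev 3: row 127, B77, K61).
HONESTY: nothing here touches the skeleton or the stub; no Theorems/ file; BSD is NOT proved, the crux is NOT proved,
the stub is NOT proved, HARDEST (a)/(b) are NOT closed.  Every `theorem` below is sorry-free; the `def … : Prop` are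
statement SHAPES (receptacles), not claims.  `MeasureValue` (§0) = k3-g42's PIECE 3 = critic certificate
`critic_g43_junction.lean` l. 737 VERBATIM (B73).

THE POINT (weakest sufficient = strongest necessary, AT FINITE LEVEL).  v7.8 leaves on the value side ONE research
node, the GLOBAL `x`-law (HARDEST (a) ≡ (b″-glob), B77), reaching the receptacle
`MeasureValue ι v v̄ Sθ Extra r l (‖·‖ ≤ 2^{−M/2})` «either in VALUE currency (RT⁺) or in COLUMN currency (Rubin's own
proof currency; then A′'s frame is the converter)».  The frame integrand `f = r·l` has INFINITE image, so both the
receptacle's value `∫ f dμ` and the frame's column `∫ f d col` are LIMITS of finite twisted sums; for a bounded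
distribution in an ultrametric field the inequality the consumer owes (B75) has an EXACT finite-level equivalent:
  §1  ‖∫ f dD‖ ≤ ε  ⟺  ‖RS_n f‖ ≤ ε for all n ≥ N(ε)   (any bound, once bound·osc ≤ ε; an EQUIVALENCE);
  §2  hence the receptacle: `MeasureValue(‖·‖ ≤ ε) ⟺ MassValue ε` — ONE twisted MASS sum `Σ_a μ_N(a)·(r·l)(ã)` per
      witness; and the column currency: `v₂(∫ ρ_v d col) ≥ M′ ⟺ ∃N ∀m ≥ N, v₂(S_m) ≥ M′`, `S_m` the FINITE
      `ρ_v`-twisted sum of `2`-adic logs of ONE norm-coherent elliptic unit at level `m` — the levelwise form in which a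
      GLOBAL input that lives at finite levels (Euler-system divisibility of the elliptic-unit classes relative to
      `κ(y₀)`; `p`-adic Gross–Zagier (5)₂; stmt-23721 by name — B77) can be consumed with nothing lost;
  §3  the smoothing `12(σ_𝔞 − N𝔞)` is an operator on integrands, uniform over ALL multiplicative integrands (finite
      order or not) — the frame-character instance of II.4.12;
  §4  the threshold at the frame character: `‖val‖ ≤ 2^{−M/2}` iff the column has norm `≤ 2^{−(M/2 + 2 + s + n/2)}`
      (digits of rows 123/127 as hypotheses, not re-derived — K59/K61);
  §5  `RiemannSumFactorisation[UpTo]`: if the witness's Riemann sums factor through the column (exactly or modulo the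
      target precision), (b) ⟺ «eventually ‖S_m‖ ≤ ε/‖c‖» (robust to the error term);
  §6  the LEDGER digit (LTE): `v₂(Σ_{x<2^m} u^x) = m` for `u ≡ 1 (4)`, `u ≠ 1` — passing from coset VALUES of
      finite-order characters to MASSES costs `|G_N|⁻¹`, repaid with ZERO slack by the truncated frame character; the
      measure-side mechanism behind B77's «every bit beyond the local ceiling is GLOBAL»: the index can enter only
      through cancellation ACROSS characters / cells, never through per-character digits.
-/
import Literature.NumberTheory.EllipticCurves.DeShalit1987.LMeasureExistence
import HarnessLib

set_option linter.dupNamespace false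
set_option autoImplicit false

noncomputable section

namespace Summit.BirchSwinnertonDyer.BirchSwinnertonDyer.Cruxes.SplitBadTwoLowerHalfOfFacts.WeakStrongK1G42

open scoped Classical
open Filter Topology
open NumberField IsDedekindDomain Field
open Literature.NumberTheory.GaloisRepresentations
open Literature.NumberTheory.EllipticCurves
open Literature.NumberTheory.EllipticCurves.DeShalit1987

/-! ## §1 The MASS FORM of a value bound (generic bounded distribution; μ.bound ≤ 1) -/

section Mass

variable {G : Type*} [Group G] {𝒰 : SubgroupTower G} {𝕜 : Type*} [NormedField 𝕜]
  [CompleteSpace 𝕜] [IsUltrametricDist 𝕜]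

/-- **Bound-agnostic form** (for the unit-log COLUMN distribution, whose bound need not be `≤ 1`): if `f` varies by
at most `δ` on the cells of every level `≥ N`, then `‖∫ f dD‖ ≤ max (D.bound·δ) ‖RS_n f‖` for every `n ≥ N`.
[cite: deShalit1987, I.3.1 (p. 16)] -/
theorem norm_integral_le_max_riemannSum (D : GroupDistribution 𝒰 𝕜) {f : G → 𝕜}
    (hf : 𝒰.IsTowerContinuous f) {δ : ℝ} (hδ : 0 ≤ δ) {N : ℕ}
    (hN : ∀ n, N ≤ n → ∀ σ τ : G, 𝒰.proj n σ = 𝒰.proj n τ → ‖f σ - f τ‖ ≤ δ)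
    {n : ℕ} (hn : N ≤ n) : ‖D.integral f‖ ≤ max (D.bound * δ) ‖D.riemannSum f n‖ := by
  have h1 : ‖D.integral f - D.riemannSum f n‖ ≤ D.bound * δ := D.norm_integral_sub_riemannSum_le hf hδ hN hn
  calc ‖D.integral f‖ = ‖(D.integral f - D.riemannSum f n) + D.riemannSum f n‖ := by rw [sub_add_cancel]
    _ ≤ max ‖D.integral f - D.riemannSum f n‖ ‖D.riemannSum f n‖ := IsUltrametricDist.norm_add_le_max _ _
    _ ≤ max (D.bound * δ) ‖D.riemannSum f n‖ := max_le_max h1 le_rfl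

/-- … and conversely `‖RS_n f‖ ≤ max (D.bound·δ) ‖∫ f dD‖` for every `n ≥ N`.
[cite: deShalit1987, I.3.1 (p. 16)] -/
theorem norm_riemannSum_le_max_integral (D : GroupDistribution 𝒰 𝕜) {f : G → 𝕜}
    (hf : 𝒰.IsTowerContinuous f) {δ : ℝ} (hδ : 0 ≤ δ) {N : ℕ}
    (hN : ∀ n, N ≤ n → ∀ σ τ : G, 𝒰.proj n σ = 𝒰.proj n τ → ‖f σ - f τ‖ ≤ δ)
    {n : ℕ} (hn : N ≤ n) : ‖D.riemannSum f n‖ ≤ max (D.bound * δ) ‖D.integral f‖ := by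
  have h1 : ‖D.integral f - D.riemannSum f n‖ ≤ D.bound * δ := D.norm_integral_sub_riemannSum_le hf hδ hN hn
  have h2 := IsUltrametricDist.norm_add_le_max (D.integral f) (-(D.integral f - D.riemannSum f n))
  rw [norm_neg, ← sub_eq_add_neg, sub_sub_cancel] at h2
  exact h2.trans (max_le (le_max_of_le_right le_rfl) (le_max_of_le_left h1))

/-- **COLUMN FORM, any bound**: once the oscillation error `D.bound·δ` is below the target `ε`,
`‖∫ f dD‖ ≤ ε ⟺ ‖RS_n f‖ ≤ ε for all n ≥ N` — for the unit-log column distribution this reads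
«`v₂(∫ ρ_v d col) ≥ M′` ⟺ eventually `v₂(S_m) ≥ M′`», `S_m` the FINITE `ρ_v`-twisted log-sum at level `m`.
[cite: deShalit1987, I.3.1 (p. 16)] -/
theorem norm_integral_le_iff_riemannSum_of_bound (D : GroupDistribution 𝒰 𝕜) {f : G → 𝕜}
    (hf : 𝒰.IsTowerContinuous f) {δ ε : ℝ} (hδ : 0 ≤ δ) (hδε : D.bound * δ ≤ ε) {N : ℕ}
    (hN : ∀ n, N ≤ n → ∀ σ τ : G, 𝒰.proj n σ = 𝒰.proj n τ → ‖f σ - f τ‖ ≤ δ) :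
    ‖D.integral f‖ ≤ ε ↔ ∀ n, N ≤ n → ‖D.riemannSum f n‖ ≤ ε :=
  ⟨fun hI _ hn ↦ (norm_riemannSum_le_max_integral D hf hδ hN hn).trans (max_le hδε hI),
    fun h ↦ (norm_integral_le_max_riemannSum D hf hδ hN le_rfl).trans (max_le hδε (h N le_rfl))⟩

/-- **Weakest sufficient finite-level form.** If `f` varies by at most `ε` on the cells of every level `≥ N`,
`μ.bound ≤ 1`, and ONE Riemann sum `RS_n f` (`n ≥ N`) has norm `≤ ε`, then `‖∫ f dμ‖ ≤ ε`.
[cite: deShalit1987, I.3.1 (p. 16)] -/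
theorem norm_integral_le_of_riemannSum (D : GroupDistribution 𝒰 𝕜) {f : G → 𝕜}
    (hf : 𝒰.IsTowerContinuous f) (hb : D.bound ≤ 1) {ε : ℝ} (hε : 0 ≤ ε) {N : ℕ}
    (hN : ∀ n, N ≤ n → ∀ σ τ : G, 𝒰.proj n σ = 𝒰.proj n τ → ‖f σ - f τ‖ ≤ ε)
    {n : ℕ} (hn : N ≤ n) (hRS : ‖D.riemannSum f n‖ ≤ ε) : ‖D.integral f‖ ≤ ε := by
  have h1 : ‖D.integral f - D.riemannSum f n‖ ≤ ε :=
    (D.norm_integral_sub_riemannSum_le hf hε hN hn).trans (mul_le_of_le_one_left hε hb)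
  calc ‖D.integral f‖ = ‖(D.integral f - D.riemannSum f n) + D.riemannSum f n‖ := by rw [sub_add_cancel]
    _ ≤ max ‖D.integral f - D.riemannSum f n‖ ‖D.riemannSum f n‖ := IsUltrametricDist.norm_add_le_max _ _
    _ ≤ ε := max_le h1 hRS

/-- **… and it is necessary**: if `‖∫ f dμ‖ ≤ ε` then EVERY Riemann sum from level `N` on has norm `≤ ε`.
[cite: deShalit1987, I.3.1 (p. 16)] -/
theorem norm_riemannSum_le_of_integral (D : GroupDistribution 𝒰 𝕜) {f : G → 𝕜}
    (hf : 𝒰.IsTowerContinuous f) (hb : D.bound ≤ 1) {ε : ℝ} (hε : 0 ≤ ε) {N : ℕ}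
    (hN : ∀ n, N ≤ n → ∀ σ τ : G, 𝒰.proj n σ = 𝒰.proj n τ → ‖f σ - f τ‖ ≤ ε)
    (hI : ‖D.integral f‖ ≤ ε) {n : ℕ} (hn : N ≤ n) : ‖D.riemannSum f n‖ ≤ ε := by
  have h1 : ‖D.integral f - D.riemannSum f n‖ ≤ ε :=
    (D.norm_integral_sub_riemannSum_le hf hε hN hn).trans (mul_le_of_le_one_left hε hb)
  have h2 := IsUltrametricDist.norm_add_le_max (D.integral f) (-(D.integral f - D.riemannSum f n))
  rw [norm_neg, ← sub_eq_add_neg, sub_sub_cancel] at h2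
  exact h2.trans (max_le hI h1)

/-- **MASS FORM ⟺ VALUE BOUND** (the finite-level home of B75 «LOWER consumes an inequality»).
[cite: deShalit1987, I.3.1 (p. 16)] -/
theorem norm_integral_le_iff_riemannSum (D : GroupDistribution 𝒰 𝕜) {f : G → 𝕜}
    (hf : 𝒰.IsTowerContinuous f) (hb : D.bound ≤ 1) {ε : ℝ} (hε : 0 ≤ ε) {N : ℕ}
    (hN : ∀ n, N ≤ n → ∀ σ τ : G, 𝒰.proj n σ = 𝒰.proj n τ → ‖f σ - f τ‖ ≤ ε) :
    ‖D.integral f‖ ≤ ε ↔ ∀ n, N ≤ n → ‖D.riemannSum f n‖ ≤ ε :=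
  ⟨fun hI _ hn ↦ norm_riemannSum_le_of_integral D hf hb hε hN hI hn,
    fun h ↦ norm_integral_le_of_riemannSum D hf hb hε hN le_rfl (h N le_rfl)⟩

/-! ## §3 Smoothing is an operator on integrands, uniform over every multiplicative integrand -/

/-- **The twisting measure `a·(σ₀ − N)` acts on ANY multiplicative integrand by the scalar `a·(f σ₀ − N)`** —
finite-order `χ̂⁻¹` and the infinite-order frame character `r·l` alike (de Shalit's `δ_𝔞 = σ_𝔞 − N𝔞`,
`μ_𝔞 = 12·δ_𝔞·μ(𝔣)`).  [cite: deShalit1987, II.4.12 proof (p. 67–69), II.4.14 Step 1 (p. 71)] -/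
theorem integral_twist_eq (D : GroupDistribution 𝒰 𝕜) {f : G → 𝕜} (hf : 𝒰.IsTowerContinuous f)
    (hmul : ∀ σ τ : G, f (σ * τ) = f σ * f τ) (σ₀ : G) (a N : 𝕜) :
    D.integral (fun τ ↦ a * (f (σ₀ * τ) - N * f τ)) = a * (f σ₀ - N) * D.integral f := by
  have h : (fun τ ↦ a * (f (σ₀ * τ) - N * f τ)) = fun τ ↦ (a * (f σ₀ - N)) * f τ := by
    funext τ; rw [hmul]; ring
  rw [h, D.integral_const_mul _ hf]

omit [CompleteSpace 𝕜] [IsUltrametricDist 𝕜] in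
/-- The same at every finite level (no continuity needed): `RS_n (a·(f(σ₀·) − N·f)) = a·(f σ₀ − N)·RS_n f`.
[cite: deShalit1987, I.3.1 (p. 16)] -/
theorem riemannSum_twist_eq (D : GroupDistribution 𝒰 𝕜) {f : G → 𝕜}
    (hmul : ∀ σ τ : G, f (σ * τ) = f σ * f τ) (σ₀ : G) (a N : 𝕜) (n : ℕ) :
    D.riemannSum (fun τ ↦ a * (f (σ₀ * τ) - N * f τ)) n = a * (f σ₀ - N) * D.riemannSum f n := by
  have h : (fun τ ↦ a * (f (σ₀ * τ) - N * f τ)) = fun τ ↦ (a * (f σ₀ - N)) * f τ := by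
    funext τ; rw [hmul]; ring
  rw [h, D.riemannSum_const_mul]

/-! ## §5 Factorised Riemann sums: the S-node of (b) as an eventual bound on FINITE sums -/

/-- **Receptacle (producer's output shape): the frame-level Kronecker formula AT FINITE LEVEL** — from level
`N` on, the Riemann sums of `f` factor as a fixed nonzero constant `c` (smoothing⁻¹ × Gauss factor of the
quadratic `l`) times a «column» `S m` (the producer instantiates `S m := Σ_{h ∈ cells m} f(repr h)·log j_p(h·u_m)`
for ONE norm-coherent θ-unit tower `u_m`, summing the coset identities over `Ĝ_m`). A DEFINITION, not a claim. -/
def RiemannSumFactorisation (D : GroupDistribution 𝒰 𝕜) (f : G → 𝕜) (c : 𝕜) (S : ℕ → 𝕜) (N : ℕ) : Prop :=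
  ∀ m, N ≤ m → D.riemannSum f m = c * S m

/-- **(b) ⟺ «eventually ‖S_m‖ ≤ ε/‖c‖»** under a Riemann-sum factorisation: the value bound is EQUIVALENT to a
bound on the finite twisted unit-log columns from some level on.  [cite: deShalit1987, I.3.1 (p. 16)] -/
theorem norm_integral_le_iff_column (D : GroupDistribution 𝒰 𝕜) {f : G → 𝕜}
    (hf : 𝒰.IsTowerContinuous f) (hb : D.bound ≤ 1) {ε : ℝ} (hε : 0 ≤ ε) {N₁ : ℕ}
    (hN : ∀ n, N₁ ≤ n → ∀ σ τ : G, 𝒰.proj n σ = 𝒰.proj n τ → ‖f σ - f τ‖ ≤ ε)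
    {c : 𝕜} {S : ℕ → 𝕜} {N₂ : ℕ} (hfac : RiemannSumFactorisation D f c S N₂) (hc : c ≠ 0) :
    ‖D.integral f‖ ≤ ε ↔ ∀ m, max N₁ N₂ ≤ m → ‖S m‖ ≤ ε / ‖c‖ := by
  have hc' : 0 < ‖c‖ := norm_pos_iff.mpr hc
  constructor
  · intro hI m hm
    have hRS := norm_riemannSum_le_of_integral D hf hb hε hN hI (le_of_max_le_left hm)
    rw [hfac m (le_of_max_le_right hm), norm_mul] at hRS
    rw [le_div_iff₀ hc', mul_comm]
    exact hRS
  · intro h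
    have hm := h (max N₁ N₂) le_rfl
    refine norm_integral_le_of_riemannSum D hf hb hε hN (n := max N₁ N₂) (le_max_left _ _) ?_
    rw [hfac _ (le_max_right _ _), norm_mul]
    rw [le_div_iff₀ hc', mul_comm] at hm
    exact hm

/-- **Receptacle, robust form: factorisation UP TO `η`** — from level `N` on, `‖RS_m f − c·S_m‖ ≤ η` (the producer's
frame-level Kronecker formula need only hold modulo the target precision; no convergence of `S_m` is asked). -/
def RiemannSumFactorisationUpTo (D : GroupDistribution 𝒰 𝕜) (f : G → 𝕜) (c : 𝕜) (S : ℕ → 𝕜) (N : ℕ) (η : ℝ) :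
    Prop :=
  ∀ m, N ≤ m → ‖D.riemannSum f m - c * S m‖ ≤ η

omit [CompleteSpace 𝕜] [IsUltrametricDist 𝕜] in
/-- Exact factorisation is the case `η = 0` (and hence every `η ≥ 0`). -/
theorem RiemannSumFactorisation.upTo {D : GroupDistribution 𝒰 𝕜} {f : G → 𝕜} {c : 𝕜} {S : ℕ → 𝕜} {N : ℕ}
    (h : RiemannSumFactorisation D f c S N) {η : ℝ} (hη : 0 ≤ η) : RiemannSumFactorisationUpTo D f c S N η := by
  intro m hm; rw [h m hm, sub_self, norm_zero]; exact hη

/-- **(b) ⟺ «eventually ‖S_m‖ ≤ ε/‖c‖»** already under a factorisation UP TO the target precision `ε`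
(ultrametric: the error term is absorbed, both directions).  [cite: deShalit1987, I.3.1 (p. 16)] -/
theorem norm_integral_le_iff_column_upTo (D : GroupDistribution 𝒰 𝕜) {f : G → 𝕜}
    (hf : 𝒰.IsTowerContinuous f) (hb : D.bound ≤ 1) {ε : ℝ} (hε : 0 ≤ ε) {N₁ : ℕ}
    (hN : ∀ n, N₁ ≤ n → ∀ σ τ : G, 𝒰.proj n σ = 𝒰.proj n τ → ‖f σ - f τ‖ ≤ ε)
    {c : 𝕜} {S : ℕ → 𝕜} {N₂ : ℕ} (hfac : RiemannSumFactorisationUpTo D f c S N₂ ε) (hc : c ≠ 0) :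
    ‖D.integral f‖ ≤ ε ↔ ∀ m, max N₁ N₂ ≤ m → ‖S m‖ ≤ ε / ‖c‖ := by
  have hc' : 0 < ‖c‖ := norm_pos_iff.mpr hc
  constructor
  · intro hI m hm
    have hRS := norm_riemannSum_le_of_integral D hf hb hε hN hI (le_of_max_le_left hm)
    have he := hfac m (le_of_max_le_right hm)
    have h2 := IsUltrametricDist.norm_add_le_max (D.riemannSum f m) (-(D.riemannSum f m - c * S m))
    rw [norm_neg, ← sub_eq_add_neg, sub_sub_cancel, norm_mul] at h2
    rw [le_div_iff₀ hc', mul_comm]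
    exact h2.trans (max_le hRS he)
  · intro h
    have hm := h (max N₁ N₂) le_rfl
    rw [le_div_iff₀ hc', mul_comm] at hm
    have he := hfac (max N₁ N₂) (le_max_right _ _)
    refine norm_integral_le_of_riemannSum D hf hb hε hN (n := max N₁ N₂) (le_max_left _ _) ?_
    have h2 := IsUltrametricDist.norm_add_le_max (D.riemannSum f (max N₁ N₂) - c * S (max N₁ N₂))
      (c * S (max N₁ N₂))
    rw [sub_add_cancel, norm_mul] at h2
    exact h2.trans (max_le he hm)

/-! ## §4 The three-factor threshold at the frame character (norms only, B75) -/

omit [CompleteSpace 𝕜] [IsUltrametricDist 𝕜] in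
/-- `val = c·u`, `c ≠ 0`: `‖val‖ ≤ t ↔ ‖u‖ ≤ t/‖c‖`. -/
theorem norm_le_iff_of_eq_const_mul {val c u : 𝕜} (h : val = c * u) (hc : c ≠ 0) (t : ℝ) :
    ‖val‖ ≤ t ↔ ‖u‖ ≤ t / ‖c‖ := by
  rw [h, norm_mul, le_div_iff₀ (norm_pos_iff.mpr hc), mul_comm]

omit [CompleteSpace 𝕜] [IsUltrametricDist 𝕜] in
/-- **The constant of the frame-level Kronecker formula has norm `2^{2 + s + n/2}`**: smoothing `a = 12`
(`‖12‖₂ = 1/4`), `b = (r·l)(σ_𝔞)⁻¹ − N𝔞` of norm `2^{−s}` (smoothing digit, choice of `𝔞`), Gauss factor of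
norm `2^{n/2}` (row 123's digit under H4′). -/
theorem norm_frameConst {a b g : 𝕜} {s n : ℝ} (ha : ‖a‖ = 4⁻¹) (hb : ‖b‖ = (2 : ℝ) ^ (-s))
    (hg : ‖g‖ = (2 : ℝ) ^ (n / 2)) : ‖(a * b)⁻¹ * g‖ = (2 : ℝ) ^ (2 + s + n / 2) := by
  rw [norm_mul, norm_inv, norm_mul, ha, hb, hg]
  have h4 : (4 : ℝ)⁻¹ = (2 : ℝ) ^ (-(2 : ℝ)) := by
    rw [Real.rpow_neg (by norm_num : (0:ℝ) ≤ 2), Real.rpow_two]; norm_num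
  rw [h4, ← Real.rpow_add (by norm_num : (0:ℝ) < 2), ← Real.rpow_neg (by norm_num : (0:ℝ) ≤ 2),
    ← Real.rpow_add (by norm_num : (0:ℝ) < 2)]
  congr 1; ring

omit [CompleteSpace 𝕜] [IsUltrametricDist 𝕜] in
/-- **FRAME THRESHOLD** (R200′(b″)'s arithmetic, one-sided): for `val = (a·b)⁻¹·g·u` with the three digits,
`‖val‖ ≤ 2^{−M/2}` iff the unit-log LIMIT column `u` has `‖u‖ ≤ 2^{−(M/2 + 2 + s + n/2)}`. -/
theorem frame_threshold {val a b g u : 𝕜} {s n M : ℝ} (h : val = (a * b)⁻¹ * g * u)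
    (ha : ‖a‖ = 4⁻¹) (hb : ‖b‖ = (2 : ℝ) ^ (-s)) (hg : ‖g‖ = (2 : ℝ) ^ (n / 2))
    (hab : a * b ≠ 0) (hg0 : g ≠ 0) :
    ‖val‖ ≤ (2 : ℝ) ^ (-M / 2) ↔ ‖u‖ ≤ (2 : ℝ) ^ (-(M / 2 + 2 + s + n / 2)) := by
  rw [norm_le_iff_of_eq_const_mul h (mul_ne_zero (inv_ne_zero hab) hg0), norm_frameConst ha hb hg,
    ← Real.rpow_sub (by norm_num : (0:ℝ) < 2)]
  have : -M / 2 - (2 + s + n / 2) = -(M / 2 + 2 + s + n / 2) := by ring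
  rw [this]

end Mass

/-! ## §0 + §2 The receptacle of record and its MASS FORM on every witness -/

section Frame

variable {p : ℕ} [Fact p.Prime] {K : Type} [Field K] [NumberField K]

/-- k3-g42's **SUB-STUB PIECE 3 — J-c «THE VALUE IN MEASURE CURRENCY»** VERBATIM (critic_g43_junction.lean
l. 737; B73: one copy at port P54): for every admissible period triple and every witness `(𝒰, μ)` of the fact at
`Sθ` carrying `Extra`, the Galois integral of `r·l` satisfies `P`. -/
def MeasureValue (ι : PadicAlgCl p ≃+* ℂ) (v vbar : HeightOneSpectrum (𝓞 K)) (Sθ : Finset (HeightOneSpectrum (𝓞 K)))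
    (Extra : Finset (HeightOneSpectrum (𝓞 K)) → (𝒰 : SubgroupTower (absoluteGaloisGroup K)) →
      GroupDistribution 𝒰 ℂ_[p] → Prop)
    (r l : FramedGaloisRep K (PadicAlgCl p) 1) (P : ℂ_[p] → Prop) : Prop :=
  ∀ (Ω δ : ℂ) (Ωp : (unrIntegers p)ˣ) (𝒰 : SubgroupTower (absoluteGaloisGroup K)) (μ : GroupDistribution 𝒰 ℂ_[p]),
    (∀ n, IsOpen (𝒰.U n : Set (absoluteGaloisGroup K))) →
    (⋂ n, (𝒰.U n : Set (absoluteGaloisGroup K))) ⊆ DeShalit1987.rayKer K p Sθ → μ.bound ≤ 1 →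
    DeShalit1987.IsLMeasure ι v vbar Sθ Ω δ ((Ωp : unrIntegers p) : ℂ_[p]) 𝒰 μ → Extra Sθ 𝒰 μ →
    P (μ.integral fun σ ↦ avatarValueAt r σ * avatarValueAt l σ)

/-- **«on every witness at `Sθ` carrying `Extra`, `Q 𝒰 μ`»** — the common binder prefix of PIECE 3, abstracted
so that the mass form and the continuity datum are stated ONCE (a DEFINITION). -/
def OnWitnesses (ι : PadicAlgCl p ≃+* ℂ) (v vbar : HeightOneSpectrum (𝓞 K)) (Sθ : Finset (HeightOneSpectrum (𝓞 K)))
    (Extra : Finset (HeightOneSpectrum (𝓞 K)) → (𝒰 : SubgroupTower (absoluteGaloisGroup K)) →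
      GroupDistribution 𝒰 ℂ_[p] → Prop)
    (Q : (𝒰 : SubgroupTower (absoluteGaloisGroup K)) → GroupDistribution 𝒰 ℂ_[p] → Prop) : Prop :=
  ∀ (Ω δ : ℂ) (Ωp : (unrIntegers p)ˣ) (𝒰 : SubgroupTower (absoluteGaloisGroup K)) (μ : GroupDistribution 𝒰 ℂ_[p]),
    (∀ n, IsOpen (𝒰.U n : Set (absoluteGaloisGroup K))) →
    (⋂ n, (𝒰.U n : Set (absoluteGaloisGroup K))) ⊆ DeShalit1987.rayKer K p Sθ → μ.bound ≤ 1 →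
    DeShalit1987.IsLMeasure ι v vbar Sθ Ω δ ((Ωp : unrIntegers p) : ℂ_[p]) 𝒰 μ → Extra Sθ 𝒰 μ → Q 𝒰 μ

variable {ι : PadicAlgCl p ≃+* ℂ} {v vbar : HeightOneSpectrum (𝓞 K)} {Sθ : Finset (HeightOneSpectrum (𝓞 K))}
  {Extra : Finset (HeightOneSpectrum (𝓞 K)) → (𝒰 : SubgroupTower (absoluteGaloisGroup K)) →
    GroupDistribution 𝒰 ℂ_[p] → Prop}
  {r l : FramedGaloisRep K (PadicAlgCl p) 1}

/-- PIECE 3 is `OnWitnesses` at `Q := P (∫ r·l dμ)` — definitional. -/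
theorem measureValue_iff_onWitnesses (P : ℂ_[p] → Prop) :
    MeasureValue ι v vbar Sθ Extra r l P ↔
      OnWitnesses ι v vbar Sθ Extra (fun _ μ ↦ P (μ.integral fun σ ↦ avatarValueAt r σ * avatarValueAt l σ)) :=
  Iff.rfl

/-- **The frame integrand is tower-continuous on every witness tower** (dischargeable from `FrameData`: `r`
through the `ℤ_p²`-pair, `l` an avatar of `θ_K⁻¹`, `⋂ U_n ⊆ rayKer`; k3-g42's J-b internals) — a DEFINITION. -/
def FrameContinuous (ι : PadicAlgCl p ≃+* ℂ) (v vbar : HeightOneSpectrum (𝓞 K))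
    (Sθ : Finset (HeightOneSpectrum (𝓞 K)))
    (Extra : Finset (HeightOneSpectrum (𝓞 K)) → (𝒰 : SubgroupTower (absoluteGaloisGroup K)) →
      GroupDistribution 𝒰 ℂ_[p] → Prop)
    (r l : FramedGaloisRep K (PadicAlgCl p) 1) : Prop :=
  OnWitnesses ι v vbar Sθ Extra (fun 𝒰 _ ↦ 𝒰.IsTowerContinuous fun σ ↦ avatarValueAt r σ * avatarValueAt l σ)

/-- **MASS FORM OF (b)** — «on every witness there is a level `N` from which `r·l` oscillates by `≤ ε` on cells
and whose level-`N` TWISTED MASS SUM `Σ_a μ_N(a)·(r·l)(repr a)` has norm `≤ ε`» (a DEFINITION; `N` may depend on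
the witness, whose tower it lives on).  This — not a finite combination of coset VALUES — is frame (i-c)'s content
at finite level. -/
def MassValue (ι : PadicAlgCl p ≃+* ℂ) (v vbar : HeightOneSpectrum (𝓞 K)) (Sθ : Finset (HeightOneSpectrum (𝓞 K)))
    (Extra : Finset (HeightOneSpectrum (𝓞 K)) → (𝒰 : SubgroupTower (absoluteGaloisGroup K)) →
      GroupDistribution 𝒰 ℂ_[p] → Prop)
    (r l : FramedGaloisRep K (PadicAlgCl p) 1) (ε : ℝ) : Prop :=
  OnWitnesses ι v vbar Sθ Extra fun 𝒰 μ ↦ ∃ N : ℕ,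
    (∀ n, N ≤ n → ∀ σ τ : absoluteGaloisGroup K, 𝒰.proj n σ = 𝒰.proj n τ →
      ‖avatarValueAt r σ * avatarValueAt l σ - avatarValueAt r τ * avatarValueAt l τ‖ ≤ ε) ∧
    ‖μ.riemannSum (fun σ ↦ avatarValueAt r σ * avatarValueAt l σ) N‖ ≤ ε

/-- **MASS FORM ⟹ PIECE 3** at `P := (‖·‖ ≤ ε)` (kernel; §1). -/
theorem measureValue_of_massValue {ε : ℝ} (hε : 0 ≤ ε) (hcont : FrameContinuous ι v vbar Sθ Extra r l)
    (h : MassValue ι v vbar Sθ Extra r l ε) :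
    MeasureValue ι v vbar Sθ Extra r l (fun z ↦ ‖z‖ ≤ ε) := by
  intro Ω δ Ωp 𝒰 μ hU hN hb hL hE
  obtain ⟨N, hosc, hRS⟩ := h Ω δ Ωp 𝒰 μ hU hN hb hL hE
  exact norm_integral_le_of_riemannSum μ (hcont Ω δ Ωp 𝒰 μ hU hN hb hL hE) hb hε hosc le_rfl hRS

/-- **PIECE 3 ⟹ MASS FORM** (kernel; §1): the mass form is also NECESSARY — it is the weakest sufficient AND the
strongest necessary finite-level statement, i.e. (b) read at finite level. -/
theorem massValue_of_measureValue {ε : ℝ} (hε : 0 < ε) (hcont : FrameContinuous ι v vbar Sθ Extra r l)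
    (h : MeasureValue ι v vbar Sθ Extra r l (fun z ↦ ‖z‖ ≤ ε)) :
    MassValue ι v vbar Sθ Extra r l ε := by
  intro Ω δ Ωp 𝒰 μ hU hN hb hL hE
  have hf := hcont Ω δ Ωp 𝒰 μ hU hN hb hL hE
  obtain ⟨N, hosc⟩ := hf.exists_forall_norm_sub_le hε
  exact ⟨N, hosc, norm_riemannSum_le_of_integral μ hf hb hε.le hosc (h Ω δ Ωp 𝒰 μ hU hN hb hL hE) le_rfl⟩

/-- **(b) ⟺ its MASS FORM** for `ε > 0` (in the stub: `ε = 2^{−M/2}`). -/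
theorem measureValue_iff_massValue {ε : ℝ} (hε : 0 < ε) (hcont : FrameContinuous ι v vbar Sθ Extra r l) :
    MeasureValue ι v vbar Sθ Extra r l (fun z ↦ ‖z‖ ≤ ε) ↔ MassValue ι v vbar Sθ Extra r l ε :=
  ⟨massValue_of_measureValue hε hcont, measureValue_of_massValue hε.le hcont⟩

omit [NumberField K] in
/-- The frame integrand is multiplicative (so §3's twist lemma applies to it exactly as to `χ̂⁻¹`). -/
theorem frameIntegrand_mul (σ τ : absoluteGaloisGroup K) :
    avatarValueAt r (σ * τ) * avatarValueAt l (σ * τ) =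
      (avatarValueAt r σ * avatarValueAt l σ) * (avatarValueAt r τ * avatarValueAt l τ) := by
  rw [avatarValueAt_mul, avatarValueAt_mul]; ring

/-- **The stub's instance**: (b) at `P := (‖·‖ ≤ 2^{−M/2})` ⟺ the mass form at `ε = 2^{−M/2}`. -/
theorem measureValue_two_pow_iff_massValue (M : ℤ) (hcont : FrameContinuous ι v vbar Sθ Extra r l) :
    MeasureValue ι v vbar Sθ Extra r l (fun z ↦ ‖z‖ ≤ (2 : ℝ) ^ (-(M : ℝ) / 2)) ↔
      MassValue ι v vbar Sθ Extra r l ((2 : ℝ) ^ (-(M : ℝ) / 2)) :=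
  measureValue_iff_massValue (Real.rpow_pos_of_pos (by norm_num) _) hcont

end Frame

/-! ## §6 The denominator ledger's tight digit (LTE at 2) -/

section Ledger

/-- **`v₂(Σ_{x<2^m} u^x) = m` for `u ≡ 1 (mod 4)`, `u ≠ 1`**: the level-`m` average of the truncated frame
character over one `ℤ₂`-direction has valuation EXACTLY `m = log₂ #cells` — the normalised Fourier coefficient
`#cells⁻¹ · Σ` is a 2-adic UNIT, so passing from coset values to masses has zero valuation slack.
[cite: deShalit1987, I.3.1 (p. 16) (REMARK: no Haar measure)] -/
theorem emultiplicity_two_geom_sum {u : ℤ} (hu4 : 4 ∣ u - 1) (hu1 : u ≠ 1) (m : ℕ) :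
    emultiplicity 2 (∑ i ∈ Finset.range (2 ^ m), u ^ i) = m := by
  have hu : ¬ 2 ∣ u := by
    intro h; obtain ⟨a, ha⟩ := hu4; obtain ⟨b, hb⟩ := h; omega
  have key := Int.two_pow_two_pow_sub_pow_two_pow (y := 1) m (by simpa using hu4) hu
  rw [one_pow, ← mul_geom_sum, emultiplicity_mul Int.prime_two] at key
  have hfin : emultiplicity 2 (u - 1) ≠ ⊤ :=
    finiteMultiplicity_iff_emultiplicity_ne_top.mp
      (Int.finiteMultiplicity_iff.mpr ⟨by norm_num, sub_ne_zero.mpr hu1⟩)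
  exact (WithTop.add_left_inj hfin).mp key

/-- **Two directions: valuation `2m = log₂ #cells` exactly** (the `ℤ₂²`-pair of the frame). -/
theorem emultiplicity_two_geom_sum_prod {u₁ u₂ : ℤ} (h₁ : 4 ∣ u₁ - 1) (h₁' : u₁ ≠ 1)
    (h₂ : 4 ∣ u₂ - 1) (h₂' : u₂ ≠ 1) (m : ℕ) :
    emultiplicity 2 ((∑ i ∈ Finset.range (2 ^ m), u₁ ^ i) * ∑ j ∈ Finset.range (2 ^ m), u₂ ^ j) =
      (2 * m : ℕ) := by
  rw [emultiplicity_mul Int.prime_two, emultiplicity_two_geom_sum h₁ h₁' m,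
    emultiplicity_two_geom_sum h₂ h₂' m]
  norm_cast; ring

end Ledger

end Summit.BirchSwinnertonDyer.BirchSwinnertonDyer.Cruxes.SplitBadTwoLowerHalfOfFacts.WeakStrongK1G42

end
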